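import Mathlib
import Literature.Analysis.Calculus.LipschitzPerturbationZero

/-!
# `Balaban1983to89.B8SectE` — the unwritten surjectivity step of B8 Sect. E (GAPS G-B8-05), kernel-checked

CITATION HEADER (lean-in-tree rule 2026-08-18). Reproduction, at the level of an abstract Banach-space lemma, of
the ONE paragraph missing on p. 97 of T. Bałaban, *Spaces of regular gauge field configurations on a lattice and
gauge fixing conditions*, Comm. Math. Phys. **99**, 75–102 (1985) [Balaban1985RegularSpaces] (cell paper B8;
PDF held `paper:balaban1985-cmp99-regular-spaces-gauge-fixing`, journal page = PDF page + 74).  The paper is a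
manuscript UNDER ADJUDICATION by the audit cell `pub-balaban`; nothing of it is asserted here — this file proves
only the elementary functional-analytic step that the printed text asserts without proof, so that the uniqueness
clause (1.109) of Proposition 5 (p. 94), hence "exactly one" in Theorems 2, 4, 8, can be traced to a
kernel-checked statement plus the PRINTED bounds.

WHAT IS PRINTED (p. 97, last paragraph of Sect. E, render checked 2026-08-18): the map `X ↦ C′(λ − H′X)` (1.118) is a
contraction with fixed point `D′(λ)` (contraction constant `2B′₀C′₂(α₃+α₄) ≤ 1/2` for `α₃+α₄ ≤ 1/(4B′₀C′₂)`),
the bound `|D′(λ)| < C′₂(α₃+α₄)α₄`, and then the SENTENCE "They imply in particular that the mapping (1.113)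
transforms the set {λ : |λ| < ½α₄, |Dλ| < ½α₄(L^jη)^{-1} on Ω_j} onto a set containing {λ′ : |λ′| < ¼α₄, |Dλ′| <
¼α₄(L^jη)^{-1} on Ω_j} for α₃, α₄ sufficiently small."  The mapping (1.113) is `λ ↦ λ − H′D′(λ)`.  WHAT IS NOT
PRINTED: (a) why `D′` (hence `H′D′`) is Lipschitz in `λ` — (1.125) bounds the derivative of `C′` and (1.92)
bounds `H′`, but the Lipschitz constant of the fixed point `D′` is never derived; (b) the second contraction
solving `λ = λ′ + H′D′(λ)` for a given `λ′`, which is what "onto" requires.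

WHAT THIS FILE PROVES (abstractly; `E` any real Banach space, here the finite-dimensional space of `𝔤`-valued
lattice functions with the norm `‖λ‖ := max{|λ|, L^jη|Dλ|}` — all balls of the sentence are balls of this norm):
* `fixedPoint_lipschitz` — (a): if `D′ λ = C′ (λ − H′ (D′ λ))` on a set `S`, `C′` is `c`-Lipschitz, `H′` is a bounded
  linear map of norm `≤ B` and `c·B < 1`, then `D′` is `c/(1 − c·B)`-Lipschitz on `S`.
* `onto_of_lipschitz_half` — (b): if `F := H′D′` is `1/2`-Lipschitz on `closedBall 0 (α/2)` and `‖F λ‖ ≤ α/8` there, then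
  for every `λ′` with `‖λ′‖ < α/4` there is exactly one `λ` in `closedBall λ′ (α/4)` (⊂ the open ball of radius
  `α/2`) with `λ − F λ = λ′` — i.e. the printed "onto" sentence, with the explicit smallness `B′₀·Lip(D′) ≤ 1/2` and
  `B′₀C′₂(α₃+α₄) ≤ 1/8` in place of "sufficiently small".  Proof: Banach's fixed point theorem for `λ ↦ λ′ + F λ`,
  via `Literature.Analysis.Calculus.exists_unique_zero_of_lipschitzOnWith` (L = id).
* `b8_sectE_smallness` — the arithmetic tying (a) and (b) to the printed constants: `α₃+α₄ ≤ 1/(8B′₀C′₂)` gives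
  `Lip(H′D′) ≤ 1/2` (from (a) with `c = 2C′₂(α₃+α₄)`, `B = B′₀`) and `B′₀C′₂(α₃+α₄)α₄ ≤ α₄/8`.

Unit `b2b-balaban-adv1` (adversarial reader, group A).  Census row: GAPS.md G-B8-05 (certification of the step
modulo the PRINTED inputs (1.92), (1.125), the bound on `|D′(λ)|`, and the domain (1.119) containing the ball of
radius `½α₄`).

v1.1 (lit-balaban r05, 2026-08-20): locator tags `[cite: Balaban1985RegularSpaces, …]` added to the three
declaration docstrings (SKELETON rows B8.Claim@97, B8.Eq1.125; MISSING-SOURCES §C.2); no declaration, statement or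
proof changed.
Framing of the lit-balaban skeleton these tags serve:
statement-level skeleton of published theorems with citation tags; proofs where landed; nothing here is a claim
about the Yang–Mills mass gap.
-/

noncomputable section

namespace Literature.MathematicalPhysics.QuantumFieldTheory.Balaban1983to89.B8SectE

open Set Metric

variable {E : Type*} [NormedAddCommGroup E] [NormedSpace ℝ E]

/-- (a) Lipschitz continuity of the fixed point `D′` of `X ↦ C′(λ − H′X)`: if `D′ λ = C′ (λ − H′ (D′ λ))` for
`λ ∈ S`, `C′` is `c`-Lipschitz (on the whole space), `‖H′‖ ≤ B` and `c·B < 1`, then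
`‖D′ λ₁ − D′ λ₂‖ ≤ c/(1 − c·B) · ‖λ₁ − λ₂‖` on `S`.  (B8 p. 97: `c = 2C′₂(α₃+α₄)` from (1.125), `B = B′₀` from
(1.92); not derived in print — elementary step supplied for the fixed point D′ of (1.117)–(1.118).)
[cite: Balaban1985RegularSpaces, (1.117)–(1.118) p.96; inputs (1.125) p.97, (1.92) pp.91–92] -/
theorem fixedPoint_lipschitz (C' : E → E) (H' : E →L[ℝ] E) (D' : E → E) (S : Set E) {c B : ℝ}
    (hc : 0 ≤ c) (hcB : c * B < 1)
    (hC : ∀ x y : E, ‖C' x - C' y‖ ≤ c * ‖x - y‖) (hH : ‖H'‖ ≤ B)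
    (hfix : ∀ lam ∈ S, D' lam = C' (lam - H' (D' lam))) :
    ∀ lam₁ ∈ S, ∀ lam₂ ∈ S, ‖D' lam₁ - D' lam₂‖ ≤ c / (1 - c * B) * ‖lam₁ - lam₂‖ := by
  intro lam₁ h₁ lam₂ h₂
  have h1cB : 0 < 1 - c * B := by linarith
  have key : ‖D' lam₁ - D' lam₂‖ ≤ c * (‖lam₁ - lam₂‖ + B * ‖D' lam₁ - D' lam₂‖) := by
    have e1 := hfix lam₁ h₁
    have e2 := hfix lam₂ h₂
    calc ‖D' lam₁ - D' lam₂‖ = ‖C' (lam₁ - H' (D' lam₁)) - C' (lam₂ - H' (D' lam₂))‖ := by rw [← e1, ← e2]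
      _ ≤ c * ‖(lam₁ - H' (D' lam₁)) - (lam₂ - H' (D' lam₂))‖ := hC _ _
      _ = c * ‖(lam₁ - lam₂) - H' (D' lam₁ - D' lam₂)‖ := by rw [map_sub]; congr 2; abel
      _ ≤ c * (‖lam₁ - lam₂‖ + ‖H' (D' lam₁ - D' lam₂)‖) :=
          mul_le_mul_of_nonneg_left (norm_sub_le _ _) hc
      _ ≤ c * (‖lam₁ - lam₂‖ + B * ‖D' lam₁ - D' lam₂‖) := by
          have hh : ‖H' (D' lam₁ - D' lam₂)‖ ≤ B * ‖D' lam₁ - D' lam₂‖ :=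
            calc ‖H' (D' lam₁ - D' lam₂)‖ ≤ ‖H'‖ * ‖D' lam₁ - D' lam₂‖ := H'.le_opNorm _
              _ ≤ B * ‖D' lam₁ - D' lam₂‖ := mul_le_mul_of_nonneg_right hH (norm_nonneg _)
          exact mul_le_mul_of_nonneg_left (by linarith) hc
  have h2 : (1 - c * B) * ‖D' lam₁ - D' lam₂‖ ≤ c * ‖lam₁ - lam₂‖ := by nlinarith [key]
  rw [div_mul_eq_mul_div, le_div_iff₀ h1cB]
  linarith

variable [CompleteSpace E]

/-- (b) The "onto" sentence of B8 p. 97, abstractly: if `F` is `1/2`-Lipschitz on `closedBall 0 (α/2)` and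
`‖F λ‖ ≤ α/8` there, then every `λ′` with `‖λ′‖ < α/4` has exactly one preimage `λ` under `λ ↦ λ − F λ` in
`closedBall λ′ (α/4)`, and that `λ` satisfies `‖λ‖ < α/2`.  (B8: `F = H′D′`, `α = α₄`; the two hypotheses are
`Lip(H′D′) ≤ 1/2` and `|H′D′(λ)| ≤ B′₀C′₂(α₃+α₄)α₄ ≤ α₄/8`.)  Banach fixed point; this is the sentence
«the mapping (1.113) transforms the set {λ: |λ| < ½α₄, …} onto a set containing {λ′: |λ′| < ¼α₄, …}» stated
without proof on p. 97 and used for the uniqueness clause (1.109) of Proposition 5 (p. 94).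
[cite: Balaban1985RegularSpaces, p.97 (after (1.125)); (1.113) p.95; (1.109) p.94] -/
theorem onto_of_lipschitz_half (F : E → E) {α : ℝ} (hα : 0 ≤ α)
    (hlip : ∀ x ∈ closedBall (0 : E) (α / 2), ∀ y ∈ closedBall (0 : E) (α / 2),
      ‖F x - F y‖ ≤ (1 / 2) * ‖x - y‖)
    (hsmall : ∀ x ∈ closedBall (0 : E) (α / 2), ‖F x‖ ≤ α / 8)
    (lam' : E) (hlam' : ‖lam'‖ < α / 4) :
    (∃! lam : E, lam ∈ closedBall lam' (α / 4) ∧ lam - F lam = lam') ∧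
      ∀ lam ∈ closedBall lam' (α / 4), ‖lam‖ < α / 2 := by
  have hsub : closedBall lam' (α / 4) ⊆ closedBall (0 : E) (α / 2) := by
    intro x hx
    rw [mem_closedBall, dist_eq_norm] at hx
    rw [mem_closedBall, dist_zero_right]
    calc ‖x‖ = ‖(x - lam') + lam'‖ := by congr 1; abel
      _ ≤ ‖x - lam'‖ + ‖lam'‖ := norm_add_le _ _
      _ ≤ α / 4 + α / 4 := by linarith
      _ = α / 2 := by ring
  refine ⟨?_, ?_⟩
  · -- apply the Literature lemma with `L = id`, `N = -F`, `θ₀ = lam'`, `r = α/4`, `K = 1/2`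
    set L : E ≃L[ℝ] E := ContinuousLinearEquiv.refl ℝ E
    set N : E → E := fun x ↦ -F x
    have hN : LipschitzOnWith (1 / 2 : NNReal) N (closedBall lam' (α / 4)) := by
      refine LipschitzOnWith.of_dist_le_mul fun x hx y hy ↦ ?_
      have := hlip x (hsub hx) y (hsub hy)
      simp only [N, dist_eq_norm]
      calc ‖-F x - -F y‖ = ‖F x - F y‖ := by rw [← norm_neg]; congr 1; abel
        _ ≤ (1 / 2) * ‖x - y‖ := this
        _ = ((1 / 2 : NNReal) : ℝ) * ‖x - y‖ := by norm_num
    have hK : ((1 / 2 : NNReal) : ℝ) * ‖(L.symm : E →L[ℝ] E)‖ ≤ 1 / 2 := by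
      have : ‖(L.symm : E →L[ℝ] E)‖ ≤ 1 := by
        rw [ContinuousLinearEquiv.refl_symm, ContinuousLinearEquiv.coe_refl]
        exact ContinuousLinearMap.norm_id_le
      have h2 : ((1 / 2 : NNReal) : ℝ) = 1 / 2 := by norm_num
      rw [h2]; nlinarith [norm_nonneg (L.symm : E →L[ℝ] E)]
    have h0 : ‖L.symm (N lam')‖ ≤ (α / 4) / 2 := by
      have hmem : lam' ∈ closedBall (0 : E) (α / 2) := by
        rw [mem_closedBall, dist_zero_right]; linarith
      have := hsmall lam' hmem
      have e : ‖L.symm (N lam')‖ = ‖F lam'‖ := by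
        simp only [L, N, ContinuousLinearEquiv.refl_symm, ContinuousLinearEquiv.coe_refl', id, norm_neg]
      rw [e]; linarith
    obtain ⟨θ, ⟨hθmem, hθ⟩, huniq⟩ :=
      Literature.Analysis.Calculus.exists_unique_zero_of_lipschitzOnWith L N lam' (by linarith) hN hK h0
    have hiff : ∀ x : E, L (x - lam') + N x = 0 ↔ x - F x = lam' := by
      intro x
      simp only [L, N, ContinuousLinearEquiv.coe_refl', id]
      constructor
      · intro h
        have : x - lam' = F x := by
          have := sub_eq_zero.mpr h
          rw [← sub_eq_add_neg] at h
          exact sub_eq_zero.mp h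
        rw [← this]; abel
      · intro h
        rw [← h]; abel
    refine ⟨θ, ⟨hθmem, (hiff θ).1 hθ⟩, fun x ⟨hxmem, hx⟩ ↦ huniq x ⟨hxmem, (hiff x).2 hx⟩⟩
  · intro x hx
    rw [mem_closedBall, dist_eq_norm] at hx
    calc ‖x‖ = ‖(x - lam') + lam'‖ := by congr 1; abel
      _ ≤ ‖x - lam'‖ + ‖lam'‖ := norm_add_le _ _
      _ < α / 4 + α / 4 := by linarith
      _ = α / 2 := by ring

/-- The arithmetic of the printed constants (B8 p. 97): with `c = 2C′₂(α₃+α₄)` (Lipschitz constant of `C′` from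
(1.125)), `B = B′₀` (norm bound of `H′` from (1.92)) and the smallness `α₃+α₄ ≤ 1/(8B′₀C′₂)` one has
`c·B ≤ 1/4`, `B·c/(1 − c·B) ≤ 1/3 ≤ 1/2` (so `H′D′` is `1/2`-Lipschitz by `fixedPoint_lipschitz`) and
`B′₀·C′₂(α₃+α₄)·α₄ ≤ α₄/8` (the hypothesis `hsmall` of `onto_of_lipschitz_half`).  Real arithmetic on the printed
smallness «α₃ + α₄ ≤ 1/(4B′₀C′₂)» (here halved). [cite: Balaban1985RegularSpaces, p.97 (after (1.125))] -/
theorem b8_sectE_smallness {B₀' C₂' α₃ α₄ : ℝ} (hB : 0 < B₀') (hC : 0 < C₂') (h4 : 0 ≤ α₄)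
    (hsm : α₃ + α₄ ≤ 1 / (8 * B₀' * C₂')) :
    (2 * C₂' * (α₃ + α₄)) * B₀' ≤ 1 / 4 ∧
    B₀' * ((2 * C₂' * (α₃ + α₄)) / (1 - (2 * C₂' * (α₃ + α₄)) * B₀')) ≤ 1 / 2 ∧
    B₀' * C₂' * (α₃ + α₄) * α₄ ≤ α₄ / 8 := by
  have hBC : 0 < 8 * B₀' * C₂' := by positivity
  have hprod : B₀' * C₂' * (α₃ + α₄) ≤ 1 / 8 := by
    have := mul_le_mul_of_nonneg_left hsm (le_of_lt (by positivity : 0 < B₀' * C₂'))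
    calc B₀' * C₂' * (α₃ + α₄) = B₀' * C₂' * (α₃ + α₄) := rfl
      _ ≤ B₀' * C₂' * (1 / (8 * B₀' * C₂')) := this
      _ = 1 / 8 := by field_simp
  have hcB : (2 * C₂' * (α₃ + α₄)) * B₀' ≤ 1 / 4 := by nlinarith
  refine ⟨hcB, ?_, ?_⟩
  · have hpos : 0 < 1 - (2 * C₂' * (α₃ + α₄)) * B₀' := by linarith
    rw [mul_div_assoc', div_le_iff₀ hpos]
    nlinarith
  · nlinarith
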